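import Mathlib
import Literature.MathematicalPhysics.QuantumFieldTheory.Balaban1983to89.T4CauchySum

/-!
# T4HybridMatching — the hybrid (term-wise + weight) matching bookkeeping of the uniqueness spine

(Cell `pub-balaban`, T4-DAG v1 nodes U5b / U5c / U5d / U5, acting row T4-U5.L; bookkeeping.)

HONEST FRAMING (cell `pub-balaban`, T4-DAG v1 PAGE 1).  The cell's T4 target is the existence AND uniqueness of the
continuum limit of Bałaban's unit-scale averaged loop expectations on a finite torus — a constructive-QFT statement
strictly beyond ultraviolet stability ([Balaban1989LargeFieldII] Thm 1 p. 355); it is NOT the Yang–Mills mass gap and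
NOT the Clay problem.  This module is the purely arithmetic half of node U5 of that spine ("matching modulo constants —
the assembly", the cell's located NEW estimate NE7 in its v1 HYBRID form: term-wise ratios for the good terms, a weight
bound for the bad ones).  It asserts NOTHING about Bałaban's renormalization-group objects: `HybridSandwich` below is a
HYPOTHESIS SHAPE over abstract finite families of nonnegative reals (a predicate, never used as a fact — the estimates
that would instantiate it are the cell's NEW estimates NE7 / NE7b, neither of them in print), and every theorem is
elementary real analysis (finite sums, `Real.log` / `Real.exp`, one monotonicity-of-the-integral step, one comparison
test).  Value = kernel bookkeeping of an implication ⇐ named inputs; NOT summit progress.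

Printed context (verbatim, page-cited; the manuscripts under audit are quoted for CONTEXT only — no disputed step of
theirs is used anywhere below).
* The printed template of a HYBRID matching is King's proof of the convergence of the partition function for the
  U(1) Higgs model in d = 2, 3 — C. King, Commun. Math. Phys. 102 (1986) 649–677, p. 656, verbatim: "We can now prove
  Theorem 2.1. We apply the renormalization transformation k times to Z^{ε_K}(T_{ε_K}, g, h) and k + n times to
  Z^{ε_{K+n}}(T_{ε_{K+n}}, g, h). Theorem 3.1 gives upper and lower bounds on these partition functions in terms of
  S^{(k),1} and S^{(k+n),1}. Since L^k ε_K = L^{k+n} ε_{K+n}, the fields A_k, φ_k have the same bounds in each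
  integral. Hence |Z^{ε_K}(T_{ε_K}, g, h) − Z^{ε_{K+n}}(T_{ε_{K+n}}, g, h)| ≤ ∫(dA_k)(dφ_k) χ_k(A_k, φ_k)
  · |exp[−S^{(k),1} + C(L^k ε_K)^σ |T|] − exp[−S^{(k+n),1} + C(L^k ε_K)^σ |T|]| + exp[−p(L^k ε_K)² + C|T|]. (3.10)
  Using Theorem 3.4 and the bound |e^x − e^y| ≤ |x − y|(e^x + e^y), (3.10) ≤ C(L^{−γk}(L^k ε_K)^{−β} + (L^k ε_K)^σ)
  |T| (Z^{ε_K} + Z^{ε_{K+n}}) · exp(C(L^k ε_K)^σ |T|) + exp[−p(L^k ε_K)² + C|T|] ≤ C(L^{−γk}(L^k ε_K)^{−β}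
  + (L^k ε_K)^σ) exp C|T|, (3.11)", and p. 657: "where we have used the ultra-violet stability bound and
  exp[−p(ε)²] ≤ ε^σ for ε small, since p ≥ 1. … Hence {Z^{ε_K}(T_{ε_K}, g, h)} is a Cauchy sequence and converges
  to a unique limit as K → ∞."  The small-field part (the χ_k-integral) is matched TERM-WISE through the effective
  actions, the large-field complement BY WEIGHT (exp[−p(L^k ε_K)² + C|T|]). [King1986, (3.10)–(3.13) pp. 656–657]
* Why d = 4 needs the RELATIVE (modulo constants) form of the same split — [Balaban1989LargeFieldI] p. 175, verbatim:
  "For d = 4 the bare coupling constant behaves asymptotically as (a + b log ε⁻¹)^{−1/2}, for ε → 0, with some positive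
  constants a, b, hence the bound does not give any positive power of ε. It is still small for ε small, and it controls
  a large number of steps, but this number is a small fraction of the total number of steps."  No ε^σ being available to
  beat e^{C|T|}, an additive bound of King's type (3.11) is useless in d = 4; the spine (T4-DAG v1 §1 D2/D3) compares
  log Z of two infrared-matched runs (A: K steps from ε = L^{−K}; B: K + 1 steps from ε/L) MODULO CONSTANTS, with the
  bad terms measured by their RELATIVE weight — the shape `HybridSandwich` / `abs_log_sum_sub_le` below.
* The printed template of the LOG-LIPSCHITZ PROPAGATION through a positive integral operation (node U5b) —
  [Balaban1989LargeFieldII] p. 380, verbatim: "exponential density in the integral is positive. This implies the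
  inequalities |T′_k(X,(U,J))F| = |T′_k(X,(U,0))e^σ F| ≤ T′_k(X,(U,0))|e^σ F| ≤ (T′_k(X,(U,0))1) sup e^{|σ|} |F|, (1.73)
  |T′_k(X,(U,J))1| = |T′_k(X,(U,0))e^σ| ≥ T′_k(X,(U,0))e^{−2|σ|} ≥ (T′_k(X,(U,0))1) e^{−2 sup|σ|}, (1.74) where σ is
  the small term of the first order in A′, J, and F is a function of the integration variables in the integral (1.71).
  The expression T′_k(X,(U,0))1 is obviously positive, although it may be very small, hence T′_k(X,(U,J))1 ≠ 0,
  and from the above inequalities we obtain |(T′_k(X,(U,J))1)^{−1} T′_k(X,(U,J))F| ≤ e^{3 sup|σ|} sup|F|. (1.75)".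
  [Balaban1989LargeFieldII, (1.73)–(1.75) p. 380]

What is proved (all [folklore]).
§0 Elementary: `x ≤ −log(1 − x)` (x < 1) and the comparison test `Summable W ∧ 0 ≤ W_K < 1 ⇒
   Summable (K ↦ −log(1 − W_K))` (`summable_neg_log_one_sub`, through −log(1 − x) ≤ 2x on [0, 1/2]).
§1 Node U5b's two propagation rules: FACTOR-WISE log bounds modulo constants add up to a TERM-WISE one
   (`abs_log_prod_sub_le`: |log ∏ψ − log ∏φ − Σc_i| ≤ Σr_i; `prod_sandwich`: the e^{∓}-form tolerant of vanishing
   factors such as synchronised characteristic functions), and a two-sided sandwich e^{c−r} f ≤ g ≤ e^{c+r} f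
   survives a positive integral operation (`integral_sandwich`; in exponential form `abs_log_integral_exp_sub_le`:
   |a′ − a − c| ≤ r a.e. ⇒ |log ∫e^{a′} − log ∫e^{a} − c| ≤ r — the (1.73)–(1.75) mechanism, proved here from
   `T4CauchySum.abs_log_integral_sub_le`).
§2 The HYBRID LEMMA (nodes U5c/U5, NE7's v1 shape).  `HybridSandwich T G a b c r W`: two finite families of
   nonnegative reals a, b on the same index set T (the two runs' term weights after U5d's partial summation), a good
   subset G ⊆ T on which e^{c−r} a_τ ≤ b_τ ≤ e^{c+r} a_τ, and bad parts of RELATIVE weight ≤ W in each run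
   (Σ_{T∖G} a ≤ W Σ_T a, Σ_{T∖G} b ≤ W Σ_T b).  Then (`lower_bound`, `upper_bound`)
   e^{c−r}(1 − W) Σ_T a ≤ Σ_T b and (1 − W) Σ_T b ≤ e^{c+r} Σ_T a, hence for W < 1 and Σ_T a > 0
   (`abs_log_sum_sub_le`) |log Σ_T b − log Σ_T a − c| ≤ r − log(1 − W).  The constant −log(1 − W) is SHARP
   (`hybridSandwich_sharp`: attained with r = 0 for every W ∈ [0,1[); the node text's "δ′_K = δ_K + w_K" (T4-DAG v1 §2
   U5c) is therefore to be read vol·δ′_K = vol·δ_K − log(1 − W_K) with W_K the relative bad weight, which agrees with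
   δ_K + w_K to first order (W ≤ −log(1 − W) ≤ 2W for W ≤ 1/2, §0) and leaves summability untouched.  `mono`: larger
   (r, W) persist (two runs with different bad weights fit with W = max).  Degenerate instances:
   pure term-wise matching (`HybridSandwich.of_termwise`, G = T, W = 0) and the one-class crude step
   (`HybridSandwich.of_abs_log_sub_le`: any two-sided bound |log z_B − log z_A − c| ≤ M is the T = G = {⋆} instance —
   how finitely many early steps, where no weight bound is small, enter the same hypothesis).
§3 Node U5d's PARTIAL SUMMATION: run B's terms s ∈ S are summed inside run A's classes along a class map π : S → T
   (`fiberSum`; `sum_fiberSum`: Σ_T fiberSum = Σ_S b, `Finset.sum_fiberwise_of_maps_to`), the bad weight transfers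
   (`sum_sdiff_fiberSum`: Σ_{T∖G} fiberSum = Σ_{s ∈ S, π s ∉ G} b), and class-wise hypotheses on S give
   `HybridSandwich T G a (fiberSum S π b)` (`HybridSandwich.of_fibers`), hence the hybrid bound with Σ_S b
   (`abs_log_sum_fibers_sub_le`).
§4 The plug into node U6: with `hybridDelta vol δ W K = δ K + (−log(1 − W K))/vol`, a hybrid sandwich of the two
   runs' term weights for every K (uniformly on |t| ≤ l₀, the constant c_K independent of t) gives
   `T4CauchySum.MatchingModConstants vol l₀ (hybridDelta vol δ W) Z` (`matchingModConstants_of_hybrid`);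
   `Summable δ ∧ Summable W ∧ 0 ≤ W_K < 1 ⇒ Summable (hybridDelta vol δ W)` (`summable_hybridDelta`); hence
   (`cauchy_of_hybrid`) every generating-function sequence K ↦ genFun Z K t, |t| ≤ l₀, is Cauchy and converges to
   `genFunLim Z` uniformly on the closed l₀-ball (by `T4CauchySum.cauchySeq_genFun` / `tendstoUniformlyOn_genFun`).
   In `T4Crossover.crossoverDelta … w K` the slot `w K` is `(−log(1 − W K))/vol`.

Deliberately NOT here: which terms are good or bad, any bound on W_K (node U5c's persistent-activity weight bound
NE7b — a large-deviation estimate "renewal cost against positional entropy", to be located in [Balaban1989LargeFieldI] /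
[Balaban1989LargeFieldII]'s conditions on N or stated new), any rate θ^j (nodes U1–U3), the synchronisation of the two
runs' discrete structures (node U5a), positivity of the actual terms (cell input L1-pos / D7; the printed positivity is
the sentence of p. 380 quoted above) — all of these are estimate rows of the cell over the tree's Bałaban vocabulary.
On NORMALISATION (cell DIVERGENCE D-pv12g4.1): `W` is the bad weight RELATIVE to the full sum of the same run at fixed
(K, t); a bound of NE7b's form "≤ w_K |T₁| × (the full sum)" is the instance W_K = w_K·vol, useful for the K with
w_K·vol < 1 (all but finitely many when Σ w_K < ∞, the torus T₁ being fixed); the finitely many early K enter through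
the one-class instance of §2 with any crude two-sided bound.  Imports: `T4CauchySum` (the U6 kernel) and Mathlib only.
-/

namespace Literature.MathematicalPhysics.QuantumFieldTheory.Balaban1983to89.T4HybridMatching

open Finset _root_.MeasureTheory _root_.Filter _root_.Topology

/-! ## §0 Elementary inequalities for −log(1 − x) and the comparison test -/

/-- `x ≤ −log(1 − x)` for `x < 1` (from `log y ≤ y − 1`). [folklore] -/
theorem le_neg_log_one_sub {x : ℝ} (hx : x < 1) : x ≤ -Real.log (1 - x) := by
  have h := Real.log_le_sub_one_of_pos (show 0 < 1 - x by linarith)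
  linarith

/-- `0 ≤ −log(1 − x)` for `0 ≤ x < 1`. [folklore] -/
theorem neg_log_one_sub_nonneg {x : ℝ} (h0 : 0 ≤ x) (h1 : x < 1) : 0 ≤ -Real.log (1 - x) :=
  h0.trans (le_neg_log_one_sub h1)

/-- COMPARISON TEST for the hybrid remainders: if `0 ≤ W_K < 1` for every `K` and `Σ W_K < ∞`, then
`Σ_K (−log(1 − W_K)) < ∞` (eventually `W_K ≤ 1/2`, where `−log(1 − W_K) ≤ 2 W_K`). [folklore] -/
theorem summable_neg_log_one_sub {W : ℕ → ℝ} (h0 : ∀ K, 0 ≤ W K) (h1 : ∀ K, W K < 1)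
    (hs : Summable W) : Summable (fun K => -Real.log (1 - W K)) := by
  -- the elementary bound `−log(1 − x) ≤ 2x` on `[0, 1/2]` (from `log y ≤ y − 1` at `y = (1 − x)⁻¹`; it is the
  -- tree's `Literature.NumberTheory.Sieve.DFI1995.neg_log_one_sub_le`, re-derived here to keep the imports minimal)
  have two_mul_bound : ∀ x : ℝ, 0 ≤ x → x ≤ 1 / 2 → -Real.log (1 - x) ≤ 2 * x := by
    intro x hx0 hx1
    have hpos : 0 < 1 - x := by linarith
    have h := Real.log_le_sub_one_of_pos (inv_pos.mpr hpos)
    rw [Real.log_inv] at h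
    have key : (1 - x)⁻¹ ≤ 1 + 2 * x := by
      have h2 : 1 ≤ (1 + 2 * x) * (1 - x) := by nlinarith
      calc (1 - x)⁻¹ = 1 * (1 - x)⁻¹ := (one_mul _).symm
        _ ≤ (1 + 2 * x) * (1 - x) * (1 - x)⁻¹ :=
            mul_le_mul_of_nonneg_right h2 (inv_nonneg.mpr hpos.le)
        _ = 1 + 2 * x := by rw [mul_inv_cancel_right₀ hpos.ne']
    linarith
  have hev : ∀ᶠ K in atTop, W K ≤ 1 / 2 :=
    hs.tendsto_atTop_zero.eventually (ge_mem_nhds (by norm_num))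
  obtain ⟨N, hN⟩ := eventually_atTop.mp hev
  have hshift : Summable (fun K => 2 * W (K + N)) :=
    (summable_nat_add_iff N).mpr (hs.mul_left 2)
  have htail : Summable (fun K => -Real.log (1 - W (K + N))) :=
    Summable.of_nonneg_of_le (fun K => neg_log_one_sub_nonneg (h0 _) (h1 _))
      (fun K => two_mul_bound _ (h0 _) (hN _ (Nat.le_add_left N K))) hshift
  exact (summable_nat_add_iff N).mp htail

/-! ## §1 Node U5b: factor-wise ⇒ term-wise, and propagation through a positive integral operation -/

/-- **Factor-wise log bounds add up** (node U5b: every factor of a term is matched modulo a constant ⇒ the term is):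
for positive factors `φ_i, ψ_i` on a finite set `s` with `|log ψ_i − log φ_i − c_i| ≤ r_i`,
`|log ∏ ψ − log ∏ φ − Σ c_i| ≤ Σ r_i`. [folklore] -/
theorem abs_log_prod_sub_le {ι : Type*} (s : Finset ι) {φ ψ : ι → ℝ} {c r : ι → ℝ}
    (hφ : ∀ i ∈ s, 0 < φ i) (hψ : ∀ i ∈ s, 0 < ψ i)
    (h : ∀ i ∈ s, |Real.log (ψ i) - Real.log (φ i) - c i| ≤ r i) :
    |Real.log (∏ i ∈ s, ψ i) - Real.log (∏ i ∈ s, φ i) - ∑ i ∈ s, c i| ≤ ∑ i ∈ s, r i := by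
  rw [Real.log_prod fun i hi => (hψ i hi).ne', Real.log_prod fun i hi => (hφ i hi).ne',
    ← Finset.sum_sub_distrib, ← Finset.sum_sub_distrib]
  exact (Finset.abs_sum_le_sum_abs _ _).trans (Finset.sum_le_sum h)

/-- **Factor-wise sandwiches multiply** (node U5b, the form tolerant of VANISHING factors — characteristic functions,
identical in the two runs after node U5a's synchronisation, are factors sandwiched with `c_i = r_i = 0`): for
`0 ≤ φ_i` and `e^{c_i−r_i} φ_i ≤ ψ_i ≤ e^{c_i+r_i} φ_i` on a finite set `s`,
`e^{Σc − Σr} ∏ φ ≤ ∏ ψ ≤ e^{Σc + Σr} ∏ φ`. [folklore] -/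
theorem prod_sandwich {ι : Type*} (s : Finset ι) {φ ψ : ι → ℝ} {c r : ι → ℝ} (hφ : ∀ i ∈ s, 0 ≤ φ i)
    (hl : ∀ i ∈ s, Real.exp (c i - r i) * φ i ≤ ψ i) (hu : ∀ i ∈ s, ψ i ≤ Real.exp (c i + r i) * φ i) :
    Real.exp (∑ i ∈ s, c i - ∑ i ∈ s, r i) * ∏ i ∈ s, φ i ≤ ∏ i ∈ s, ψ i ∧
      ∏ i ∈ s, ψ i ≤ Real.exp (∑ i ∈ s, c i + ∑ i ∈ s, r i) * ∏ i ∈ s, φ i := by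
  have hψ : ∀ i ∈ s, 0 ≤ ψ i := fun i hi => (mul_nonneg (Real.exp_pos _).le (hφ i hi)).trans (hl i hi)
  constructor
  · rw [← Finset.sum_sub_distrib, Real.exp_sum, ← Finset.prod_mul_distrib]
    exact Finset.prod_le_prod (fun i hi => mul_nonneg (Real.exp_pos _).le (hφ i hi)) hl
  · rw [← Finset.sum_add_distrib, Real.exp_sum, ← Finset.prod_mul_distrib]
    exact Finset.prod_le_prod hψ hu

/-- **A two-sided sandwich survives a positive integral operation**: `e^{c−r} f ≤ g ≤ e^{c+r} f` a.e. for
integrable `f, g` gives `e^{c−r} ∫f ≤ ∫g ≤ e^{c+r} ∫f` (node U5b: a pending positive integration — a later T-step —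
applied to two sandwiched integrands). [folklore] -/
theorem integral_sandwich {α : Type*} [MeasurableSpace α] {μ : Measure α} {f g : α → ℝ} {c r : ℝ}
    (hf : Integrable f μ) (hg : Integrable g μ)
    (hlow : ∀ᵐ x ∂μ, Real.exp (c - r) * f x ≤ g x) (hupp : ∀ᵐ x ∂μ, g x ≤ Real.exp (c + r) * f x) :
    Real.exp (c - r) * ∫ x, f x ∂μ ≤ ∫ x, g x ∂μ ∧ ∫ x, g x ∂μ ≤ Real.exp (c + r) * ∫ x, f x ∂μ := by
  constructor
  · rw [← integral_const_mul]
    exact integral_mono_ae (hf.const_mul _) hg hlow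
  · rw [← integral_const_mul]
    exact integral_mono_ae hg (hf.const_mul _) hupp

/-- **Log-Lipschitz propagation** (node U5b, the mechanism of [Balaban1989LargeFieldII] (1.73)–(1.75) p. 380 in
abstract form): for exponents `a, a′` with `|a′ − a − c| ≤ r` almost everywhere, `e^{a}, e^{a′}` integrable and
`∫ e^{a} > 0`, `|log ∫ e^{a′} − log ∫ e^{a} − c| ≤ r`.  (Any nonnegative weight is part of the measure `μ`.)
[folklore] -/
theorem abs_log_integral_exp_sub_le {α : Type*} [MeasurableSpace α] {μ : Measure α} {a a' : α → ℝ}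
    {c r : ℝ} (ha : Integrable (fun x => Real.exp (a x)) μ) (ha' : Integrable (fun x => Real.exp (a' x)) μ)
    (hpos : 0 < ∫ x, Real.exp (a x) ∂μ) (h : ∀ᵐ x ∂μ, |a' x - a x - c| ≤ r) :
    |Real.log (∫ x, Real.exp (a' x) ∂μ) - Real.log (∫ x, Real.exp (a x) ∂μ) - c| ≤ r := by
  have hlow : ∀ᵐ x ∂μ, Real.exp (c - r) * Real.exp (a x) ≤ Real.exp (a' x) :=
    h.mono fun x hx => by
      rw [← Real.exp_add]
      exact Real.exp_le_exp.mpr (by linarith [(abs_le.mp hx).1])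
  have hupp : ∀ᵐ x ∂μ, Real.exp (a' x) ≤ Real.exp (c + r) * Real.exp (a x) :=
    h.mono fun x hx => by
      rw [← Real.exp_add]
      exact Real.exp_le_exp.mpr (by linarith [(abs_le.mp hx).2])
  exact T4CauchySum.abs_log_integral_sub_le ha ha' hpos hlow hupp

/-! ## §2 The hybrid lemma (nodes U5c / U5: term-wise for the good terms, by weight for the bad ones) -/

/-- HYPOTHESIS SHAPE (node U5, cell NE7 in its v1 hybrid form — NOT in print; the printed template is King's split
(3.10) into the small-field integral and the large-field complement).  Two finite families `a, b` of NONNEGATIVE reals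
on the same index set `T` (the term weights of run A and — after node U5d's partial summation — of run B, at fixed
number of steps and fixed source strength), a GOOD subset `G ⊆ T` on which the terms are sandwiched
`e^{c−r} a_τ ≤ b_τ ≤ e^{c+r} a_τ` (term-wise matching modulo the common constant `c`), and BAD parts of relative
weight at most `W` in each run: `Σ_{T∖G} a ≤ W Σ_T a`, `Σ_{T∖G} b ≤ W Σ_T b` (node U5c's weight bound NE7b).
[cite: King1986, (3.10)–(3.11) p. 656] -/
structure HybridSandwich {ι : Type*} [DecidableEq ι] (T G : Finset ι) (a b : ι → ℝ) (c r W : ℝ) : Prop where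
  /-- the good terms are terms -/
  subset : G ⊆ T
  /-- run A's term weights are nonnegative (cell input L1-pos / D7) -/
  nonneg_left : ∀ τ ∈ T, 0 ≤ a τ
  /-- run B's term weights are nonnegative -/
  nonneg_right : ∀ τ ∈ T, 0 ≤ b τ
  /-- good terms, lower half of the sandwich -/
  lower : ∀ τ ∈ G, Real.exp (c - r) * a τ ≤ b τ
  /-- good terms, upper half of the sandwich -/
  upper : ∀ τ ∈ G, b τ ≤ Real.exp (c + r) * a τ
  /-- bad terms of run A have relative weight ≤ W -/
  bad_left : ∑ τ ∈ T \ G, a τ ≤ W * ∑ τ ∈ T, a τ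
  /-- bad terms of run B have relative weight ≤ W -/
  bad_right : ∑ τ ∈ T \ G, b τ ≤ W * ∑ τ ∈ T, b τ

namespace HybridSandwich

variable {ι : Type*} [DecidableEq ι] {T G : Finset ι} {a b : ι → ℝ} {c r W : ℝ}

/-- The good part of run B dominates `e^{c−r}` times the good part of run A. [folklore] -/
theorem sum_good_lower (h : HybridSandwich T G a b c r W) :
    Real.exp (c - r) * ∑ τ ∈ G, a τ ≤ ∑ τ ∈ G, b τ := by
  rw [Finset.mul_sum]
  exact Finset.sum_le_sum h.lower

/-- The good part of run B is at most `e^{c+r}` times the good part of run A. [folklore] -/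
theorem sum_good_upper (h : HybridSandwich T G a b c r W) :
    ∑ τ ∈ G, b τ ≤ Real.exp (c + r) * ∑ τ ∈ G, a τ := by
  rw [Finset.mul_sum]
  exact Finset.sum_le_sum h.upper

/-- **Lower bound**: `e^{c−r} (1 − W) Σ_T a ≤ Σ_T b`. [folklore] -/
theorem lower_bound (h : HybridSandwich T G a b c r W) :
    Real.exp (c - r) * (1 - W) * ∑ τ ∈ T, a τ ≤ ∑ τ ∈ T, b τ := by
  have hA := Finset.sum_sdiff (f := a) h.subset
  have hB := Finset.sum_sdiff (f := b) h.subset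
  have hbadB : 0 ≤ ∑ τ ∈ T \ G, b τ :=
    Finset.sum_nonneg fun τ hτ => h.nonneg_right τ (Finset.mem_sdiff.mp hτ).1
  have hgoodA : (1 - W) * ∑ τ ∈ T, a τ ≤ ∑ τ ∈ G, a τ := by linarith [h.bad_left]
  have h1 : Real.exp (c - r) * (1 - W) * ∑ τ ∈ T, a τ ≤ Real.exp (c - r) * ∑ τ ∈ G, a τ := by
    rw [mul_assoc]
    exact mul_le_mul_of_nonneg_left hgoodA (Real.exp_pos _).le
  linarith [h.sum_good_lower]

/-- **Upper bound**: `(1 − W) Σ_T b ≤ e^{c+r} Σ_T a`. [folklore] -/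
theorem upper_bound (h : HybridSandwich T G a b c r W) :
    (1 - W) * ∑ τ ∈ T, b τ ≤ Real.exp (c + r) * ∑ τ ∈ T, a τ := by
  have hA := Finset.sum_sdiff (f := a) h.subset
  have hB := Finset.sum_sdiff (f := b) h.subset
  have hbadA : 0 ≤ ∑ τ ∈ T \ G, a τ :=
    Finset.sum_nonneg fun τ hτ => h.nonneg_left τ (Finset.mem_sdiff.mp hτ).1
  have h2 : Real.exp (c + r) * ∑ τ ∈ G, a τ ≤ Real.exp (c + r) * ∑ τ ∈ T, a τ :=
    mul_le_mul_of_nonneg_left (by linarith) (Real.exp_pos _).le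
  linarith [h.sum_good_upper, h.bad_right]

/-- Run B's total is positive as soon as run A's is and `W < 1`. [folklore] -/
theorem sum_pos (h : HybridSandwich T G a b c r W) (hW : W < 1) (hpos : 0 < ∑ τ ∈ T, a τ) :
    0 < ∑ τ ∈ T, b τ :=
  lt_of_lt_of_le (mul_pos (mul_pos (Real.exp_pos _) (by linarith)) hpos) h.lower_bound

/-- Monotonicity in the remainders: a hybrid sandwich with `(r, W)` is one with any `r′ ≥ r`, `W′ ≥ W` (so two runs
with different bad weights `W_A, W_B` fit with `W = max W_A W_B`). [folklore] -/
theorem mono (h : HybridSandwich T G a b c r W) {r' W' : ℝ} (hr : r ≤ r') (hW : W ≤ W') :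
    HybridSandwich T G a b c r' W' where
  subset := h.subset
  nonneg_left := h.nonneg_left
  nonneg_right := h.nonneg_right
  lower := fun τ hτ => (mul_le_mul_of_nonneg_right (Real.exp_le_exp.mpr (by linarith))
    (h.nonneg_left τ (h.subset hτ))).trans (h.lower τ hτ)
  upper := fun τ hτ => (h.upper τ hτ).trans (mul_le_mul_of_nonneg_right (Real.exp_le_exp.mpr (by linarith))
    (h.nonneg_left τ (h.subset hτ)))
  bad_left := h.bad_left.trans (mul_le_mul_of_nonneg_right hW (Finset.sum_nonneg h.nonneg_left))
  bad_right := h.bad_right.trans (mul_le_mul_of_nonneg_right hW (Finset.sum_nonneg h.nonneg_right))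

/-- **THE HYBRID LEMMA** (node U5's assembly shape, cell NE7 v1): under `HybridSandwich T G a b c r W` with `W < 1`
and `Σ_T a > 0`, `|log Σ_T b − log Σ_T a − c| ≤ r − log(1 − W)`.  The remainder `−log(1 − W)` is sharp
(`hybridSandwich_sharp`). [folklore] -/
theorem abs_log_sum_sub_le (h : HybridSandwich T G a b c r W) (hW : W < 1)
    (hpos : 0 < ∑ τ ∈ T, a τ) :
    |Real.log (∑ τ ∈ T, b τ) - Real.log (∑ τ ∈ T, a τ) - c| ≤ r - Real.log (1 - W) := by
  have hW' : 0 < 1 - W := by linarith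
  have hB := h.sum_pos hW hpos
  have hlow := Real.log_le_log (mul_pos (mul_pos (Real.exp_pos _) hW') hpos) h.lower_bound
  rw [Real.log_mul (mul_pos (Real.exp_pos _) hW').ne' hpos.ne',
    Real.log_mul (Real.exp_pos _).ne' hW'.ne', Real.log_exp] at hlow
  have hupp := Real.log_le_log (mul_pos hW' hB) h.upper_bound
  rw [Real.log_mul hW'.ne' hB.ne', Real.log_mul (Real.exp_pos _).ne' hpos.ne', Real.log_exp] at hupp
  rw [abs_le]
  constructor <;> linarith

/-- Degenerate instance 1 — PURE TERM-WISE MATCHING (every term good, `G = T`, `W = 0`): nonnegative `a` and a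
term-wise sandwich give `HybridSandwich T T a b c r 0`. [folklore] -/
theorem of_termwise (ha : ∀ τ ∈ T, 0 ≤ a τ) (hl : ∀ τ ∈ T, Real.exp (c - r) * a τ ≤ b τ)
    (hu : ∀ τ ∈ T, b τ ≤ Real.exp (c + r) * a τ) : HybridSandwich T T a b c r 0 where
  subset := Finset.Subset.refl _
  nonneg_left := ha
  nonneg_right := fun τ hτ => (mul_nonneg (Real.exp_pos _).le (ha τ hτ)).trans (hl τ hτ)
  lower := hl
  upper := hu
  bad_left := by simp
  bad_right := by simp

/-- Degenerate instance 2 — ONE CLASS, CRUDE BOUND: any two-sided bound `|log z_B − log z_A − c| ≤ M` between two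
positive numbers is the hybrid sandwich with a single (good) class and `W = 0`.  This is how the finitely many early
steps, where no weight bound is small, enter the hypothesis of `matchingModConstants_of_hybrid`. [folklore] -/
theorem of_abs_log_sub_le {zA zB c M : ℝ} (hA : 0 < zA) (hB : 0 < zB)
    (h : |Real.log zB - Real.log zA - c| ≤ M) :
    HybridSandwich (Finset.univ : Finset Unit) Finset.univ (fun _ => zA) (fun _ => zB) c M 0 :=
  of_termwise (fun _ _ => hA.le)
    (fun _ _ => (T4CauchySum.two_sided_of_abs_log_sub_le hA hB h).1)
    (fun _ _ => (T4CauchySum.two_sided_of_abs_log_sub_le hA hB h).2)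

end HybridSandwich

/-- **SHARPNESS of the hybrid remainder**: for every `W ∈ [0,1[` there are two-term families with all hypotheses of
`HybridSandwich` at `c = r = 0` and `|log Σ b − log Σ a − c| = r − log(1 − W)` — equality in `abs_log_sum_sub_le`
(good term 1 ↔ 1, bad term 0 ↔ W/(1 − W)).  So `−log(1 − W)` cannot be replaced by `W`; the two agree to first
order. [folklore] -/
theorem hybridSandwich_sharp {W : ℝ} (hW0 : 0 ≤ W) (hW1 : W < 1) :
    ∃ a b : Bool → ℝ, HybridSandwich Finset.univ {true} a b 0 0 W ∧ 0 < ∑ τ, a τ ∧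
      |Real.log (∑ τ, b τ) - Real.log (∑ τ, a τ) - 0| = 0 - Real.log (1 - W) := by
  have h1W : 0 < 1 - W := by linarith
  have h1W' : (1 : ℝ) - W ≠ 0 := h1W.ne'
  have hsd : (Finset.univ : Finset Bool) \ {true} = {false} := by decide
  have hfrac : 0 ≤ W / (1 - W) := div_nonneg hW0 h1W.le
  have hinv : (1 : ℝ) + W / (1 - W) = (1 - W)⁻¹ := by
    field_simp
    ring
  refine ⟨fun τ => if τ then 1 else 0, fun τ => if τ then 1 else W / (1 - W), ?_, ?_, ?_⟩
  · refine ⟨Finset.subset_univ _, ?_, ?_, ?_, ?_, ?_, ?_⟩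
    · intro τ _
      cases τ <;> simp
    · intro τ _
      cases τ <;> simp [hfrac]
    · intro τ hτ
      rw [Finset.mem_singleton] at hτ
      subst hτ
      simp
    · intro τ hτ
      rw [Finset.mem_singleton] at hτ
      subst hτ
      simp
    · rw [hsd, Finset.sum_singleton, Fintype.sum_bool]
      simp [hW0]
    · rw [hsd, Finset.sum_singleton, Fintype.sum_bool]
      simp only [if_true, Bool.false_eq_true, if_false]
      rw [hinv]
      have : W / (1 - W) = W * (1 - W)⁻¹ := div_eq_mul_inv _ _
      rw [this]
  · rw [Fintype.sum_bool]
    simp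
  · rw [Fintype.sum_bool, Fintype.sum_bool]
    simp only [if_true, Bool.false_eq_true, if_false, add_zero, Real.log_one, sub_zero, zero_sub]
    rw [hinv, Real.log_inv, abs_of_nonneg (neg_log_one_sub_nonneg hW0 hW1)]

/-! ## §3 Node U5d: partial summation of run B's terms inside run A's classes -/

/-- The CLASS SUM of run B's term weights `b` over the fibre of the class map `π : σ → ι` above `τ`
(node U5d: B's terms carrying extra finest-scale data are summed inside each A-class). [folklore] -/
def fiberSum {σ ι : Type*} [DecidableEq ι] (S : Finset σ) (π : σ → ι) (b : σ → ℝ) (τ : ι) : ℝ :=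
  ∑ s ∈ S.filter (fun s => π s = τ), b s

/-- Partial summation loses nothing: `Σ_{τ ∈ T} fiberSum S π b τ = Σ_{s ∈ S} b s` when `π` maps `S` into `T`
(`Finset.sum_fiberwise_of_maps_to`). [folklore] -/
theorem sum_fiberSum {σ ι : Type*} [DecidableEq ι] {S : Finset σ} {T : Finset ι} {π : σ → ι} (b : σ → ℝ)
    (hmaps : ∀ s ∈ S, π s ∈ T) : ∑ τ ∈ T, fiberSum S π b τ = ∑ s ∈ S, b s := by
  unfold fiberSum
  exact Finset.sum_fiberwise_of_maps_to hmaps b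

/-- Class sums of nonnegative weights are nonnegative. [folklore] -/
theorem fiberSum_nonneg {σ ι : Type*} [DecidableEq ι] {S : Finset σ} {π : σ → ι} {b : σ → ℝ}
    (hb : ∀ s ∈ S, 0 ≤ b s) (τ : ι) : 0 ≤ fiberSum S π b τ :=
  Finset.sum_nonneg fun s hs => hb s (Finset.mem_filter.mp hs).1

/-- The bad weight transfers along the class map: `Σ_{τ ∈ T∖G} fiberSum S π b τ = Σ_{s ∈ S, π s ∉ G} b s`.
[folklore] -/
theorem sum_sdiff_fiberSum {σ ι : Type*} [DecidableEq ι] {S : Finset σ} {T G : Finset ι} {π : σ → ι}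
    (b : σ → ℝ) (hmaps : ∀ s ∈ S, π s ∈ T) :
    ∑ τ ∈ T \ G, fiberSum S π b τ = ∑ s ∈ S.filter (fun s => π s ∉ G), b s := by
  unfold fiberSum
  rw [← Finset.sum_fiberwise_of_maps_to (s := S.filter (fun s => π s ∉ G)) (t := T \ G) (g := π)
    (fun s hs => Finset.mem_sdiff.mpr ⟨hmaps s (Finset.mem_filter.mp hs).1, (Finset.mem_filter.mp hs).2⟩) b]
  refine Finset.sum_congr rfl fun τ hτ => Finset.sum_congr ?_ fun _ _ => rfl
  ext s
  simp only [Finset.mem_filter]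
  constructor
  · rintro ⟨hs, hπ⟩
    exact ⟨⟨hs, hπ ▸ (Finset.mem_sdiff.mp hτ).2⟩, hπ⟩
  · rintro ⟨⟨hs, _⟩, hπ⟩
    exact ⟨hs, hπ⟩

/-- **Node U5d ⇒ the hybrid hypothesis on A's index set.**  Class-wise data — `G ⊆ T`, `π` maps `S` into `T`,
nonnegative weights, the class sums over good classes sandwiched against A's terms, A's bad classes and B's terms over
bad classes of relative weight ≤ `W` — give `HybridSandwich T G a (fiberSum S π b) c r W`; with `sum_fiberSum` the
hybrid lemma then bounds `|log Σ_S b − log Σ_T a − c|`. [folklore] -/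
theorem HybridSandwich.of_fibers {σ ι : Type*} [DecidableEq ι] {S : Finset σ} {T G : Finset ι} {π : σ → ι}
    {a : ι → ℝ} {b : σ → ℝ} {c r W : ℝ} (hGT : G ⊆ T) (hmaps : ∀ s ∈ S, π s ∈ T)
    (ha : ∀ τ ∈ T, 0 ≤ a τ) (hb : ∀ s ∈ S, 0 ≤ b s)
    (hl : ∀ τ ∈ G, Real.exp (c - r) * a τ ≤ fiberSum S π b τ)
    (hu : ∀ τ ∈ G, fiberSum S π b τ ≤ Real.exp (c + r) * a τ)
    (hbadA : ∑ τ ∈ T \ G, a τ ≤ W * ∑ τ ∈ T, a τ)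
    (hbadB : ∑ s ∈ S.filter (fun s => π s ∉ G), b s ≤ W * ∑ s ∈ S, b s) :
    HybridSandwich T G a (fiberSum S π b) c r W where
  subset := hGT
  nonneg_left := ha
  nonneg_right := fun τ _ => fiberSum_nonneg hb τ
  lower := hl
  upper := hu
  bad_left := hbadA
  bad_right := by
    rw [sum_sdiff_fiberSum b hmaps, sum_fiberSum b hmaps]
    exact hbadB

/-- **Node U5d + the hybrid lemma, stated on run B's own index set**: under the class-wise data of
`HybridSandwich.of_fibers` with `W < 1` and `Σ_T a > 0`, `|log Σ_{s ∈ S} b s − log Σ_{τ ∈ T} a τ − c| ≤ r − log(1 − W)`.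
[folklore] -/
theorem abs_log_sum_fibers_sub_le {σ ι : Type*} [DecidableEq ι] {S : Finset σ} {T G : Finset ι} {π : σ → ι}
    {a : ι → ℝ} {b : σ → ℝ} {c r W : ℝ} (hGT : G ⊆ T) (hmaps : ∀ s ∈ S, π s ∈ T)
    (ha : ∀ τ ∈ T, 0 ≤ a τ) (hb : ∀ s ∈ S, 0 ≤ b s)
    (hl : ∀ τ ∈ G, Real.exp (c - r) * a τ ≤ fiberSum S π b τ)
    (hu : ∀ τ ∈ G, fiberSum S π b τ ≤ Real.exp (c + r) * a τ)
    (hbadA : ∑ τ ∈ T \ G, a τ ≤ W * ∑ τ ∈ T, a τ)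
    (hbadB : ∑ s ∈ S.filter (fun s => π s ∉ G), b s ≤ W * ∑ s ∈ S, b s)
    (hW : W < 1) (hpos : 0 < ∑ τ ∈ T, a τ) :
    |Real.log (∑ s ∈ S, b s) - Real.log (∑ τ ∈ T, a τ) - c| ≤ r - Real.log (1 - W) := by
  rw [← sum_fiberSum b hmaps]
  exact (HybridSandwich.of_fibers hGT hmaps ha hb hl hu hbadA hbadB).abs_log_sum_sub_le hW hpos

/-! ## §4 The plug into node U6 (`T4CauchySum.MatchingModConstants`, `cauchySeq_genFun`) -/

/-- The HYBRID REMAINDER SEQUENCE `hybridDelta vol δ W K = δ K + (−log(1 − W K))/vol`: the term-wise remainder `δ K`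
(per unit volume; node U4′'s crossover sum) plus the weight remainder `−log(1 − W K)` spread over the volume.
[folklore] -/
noncomputable def hybridDelta (vol : ℝ) (δ W : ℕ → ℝ) (K : ℕ) : ℝ :=
  δ K + -Real.log (1 - W K) / vol

/-- `vol · hybridDelta vol δ W K = vol · δ K − log(1 − W K)` for `vol ≠ 0`. [folklore] -/
theorem mul_hybridDelta {vol : ℝ} (hvol : vol ≠ 0) (δ W : ℕ → ℝ) (K : ℕ) :
    vol * hybridDelta vol δ W K = vol * δ K - Real.log (1 - W K) := by
  unfold hybridDelta
  rw [mul_add, mul_div_cancel₀ _ hvol]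
  ring

/-- The hybrid remainders are nonnegative when `δ K ≥ 0`, `0 ≤ W K < 1`, `vol > 0`. [folklore] -/
theorem hybridDelta_nonneg {vol : ℝ} (hvol : 0 < vol) {δ W : ℕ → ℝ} {K : ℕ} (hδ : 0 ≤ δ K) (h0 : 0 ≤ W K)
    (h1 : W K < 1) : 0 ≤ hybridDelta vol δ W K :=
  add_nonneg hδ (div_nonneg (neg_log_one_sub_nonneg h0 h1) hvol.le)

/-- **Summability of the hybrid remainders**: `Σ δ_K < ∞`, `Σ W_K < ∞` and `0 ≤ W_K < 1` give
`Σ_K hybridDelta vol δ W K < ∞` — the `Summable δ` input of `T4CauchySum.cauchySeq_genFun`. [folklore] -/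
theorem summable_hybridDelta {vol : ℝ} {δ W : ℕ → ℝ} (hδ : Summable δ) (h0 : ∀ K, 0 ≤ W K)
    (h1 : ∀ K, W K < 1) (hW : Summable W) : Summable (hybridDelta vol δ W) := by
  unfold hybridDelta
  exact hδ.add ((summable_neg_log_one_sub h0 h1 hW).div_const vol)

/-- **Node U5 (hybrid form) ⇒ `MatchingModConstants`.**  Let `Z K t` be the dressed partition function after `K`
steps at source strength `t` (one sequence: run A with `K` steps is `Z K`, run B with `K + 1` steps is `Z (K+1)`).
Suppose that for every `K`, on `|t| ≤ l₀`, run A's value is a finite sum `Σ_{τ ∈ T K} A K t τ` of term weights with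
positive total, run B's value is `Σ_{τ ∈ T K} B K t τ` (its terms partially summed into A's classes, §3), and for some
constant `c_K` INDEPENDENT of `t` and some good set the two families satisfy `HybridSandwich` with term-wise
remainder `vol · δ K` and relative bad weight `W K < 1`.  Then `MatchingModConstants vol l₀ (hybridDelta vol δ W) Z`.
[folklore] -/
theorem matchingModConstants_of_hybrid {ι : Type*} [DecidableEq ι] {vol l₀ : ℝ} (hvol : 0 < vol)
    {δ W : ℕ → ℝ} {Z : ℕ → ℝ → ℝ} (T : ℕ → Finset ι) (A B : ℕ → ℝ → ι → ℝ)
    (hZA : ∀ K t, |t| ≤ l₀ → Z K t = ∑ τ ∈ T K, A K t τ)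
    (hZB : ∀ K t, |t| ≤ l₀ → Z (K + 1) t = ∑ τ ∈ T K, B K t τ)
    (hW : ∀ K, W K < 1) (hpos : ∀ K t, |t| ≤ l₀ → 0 < ∑ τ ∈ T K, A K t τ)
    (h : ∀ K : ℕ, ∃ c : ℝ, ∀ t : ℝ, |t| ≤ l₀ →
      ∃ G : Finset ι, HybridSandwich (T K) G (A K t) (B K t) c (vol * δ K) (W K)) :
    T4CauchySum.MatchingModConstants vol l₀ (hybridDelta vol δ W) Z := by
  intro K
  obtain ⟨c, hc⟩ := h K
  refine ⟨c, fun t ht => ?_⟩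
  obtain ⟨G, hG⟩ := hc t ht
  rw [hZA K t ht, hZB K t ht, mul_hybridDelta hvol.ne']
  exact hG.abs_log_sum_sub_le (hW K) (hpos K t ht)

/-- **Node U5 (hybrid form) + summable remainders ⇒ node U6's Cauchy property** (CONDITIONAL kernel theorem; cf.
`T4CauchySum.cauchySum`, `T4Crossover.cauchySum_of_crossover`): under the hypotheses of
`matchingModConstants_of_hybrid`, `0 ≤ l₀`, `Σ δ_K < ∞`, `Σ W_K < ∞`, `0 ≤ W_K`, the matching modulo constants
holds with summable remainders, every generating-function sequence `K ↦ genFun Z K t`, `|t| ≤ l₀`, is Cauchy, and the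
convergence to `genFunLim Z` is uniform on the closed `l₀`-ball — the input node U0 consumes.  None of the hypotheses
is asserted here for Bałaban's objects (NE7, NE7b are NEW estimates of the cell). [folklore] -/
theorem cauchy_of_hybrid {ι : Type*} [DecidableEq ι] {vol l₀ : ℝ} (hvol : 0 < vol) (hl₀ : 0 ≤ l₀)
    {δ W : ℕ → ℝ} {Z : ℕ → ℝ → ℝ} (T : ℕ → Finset ι) (A B : ℕ → ℝ → ι → ℝ)
    (hZA : ∀ K t, |t| ≤ l₀ → Z K t = ∑ τ ∈ T K, A K t τ)
    (hZB : ∀ K t, |t| ≤ l₀ → Z (K + 1) t = ∑ τ ∈ T K, B K t τ)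
    (hW0 : ∀ K, 0 ≤ W K) (hW : ∀ K, W K < 1) (hWs : Summable W) (hδ : Summable δ)
    (hpos : ∀ K t, |t| ≤ l₀ → 0 < ∑ τ ∈ T K, A K t τ)
    (h : ∀ K : ℕ, ∃ c : ℝ, ∀ t : ℝ, |t| ≤ l₀ →
      ∃ G : Finset ι, HybridSandwich (T K) G (A K t) (B K t) c (vol * δ K) (W K)) :
    T4CauchySum.MatchingModConstants vol l₀ (hybridDelta vol δ W) Z ∧ Summable (hybridDelta vol δ W) ∧
    (∀ t : ℝ, |t| ≤ l₀ → CauchySeq fun K => T4CauchySum.genFun Z K t) ∧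
    TendstoUniformlyOn (fun K t => T4CauchySum.genFun Z K t) (T4CauchySum.genFunLim Z) atTop
      {t | |t| ≤ l₀} := by
  have hM := matchingModConstants_of_hybrid hvol T A B hZA hZB hW hpos h
  have hS := summable_hybridDelta (vol := vol) hδ hW0 hW hWs
  exact ⟨hM, hS, fun t ht => T4CauchySum.cauchySeq_genFun hM hl₀ hS ht,
    T4CauchySum.tendstoUniformlyOn_genFun hM hl₀ hS⟩

end Literature.MathematicalPhysics.QuantumFieldTheory.Balaban1983to89.T4HybridMatching
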